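import Summits.ResolutionOfSingularities.ResolutionOfSingularities.Theorems.HilbertSamuelEliminationCampaignW42ToricMarkedDefs

/-!
# [OURS · L1 W4.2] Toric marked monomial objects in dimension 3 — brick 7B: WON corners stay won (first lemma of bridge B1)

[OURS · L1 W4.2 · seat res-L1-s42-pv-2 gen 5] Memo `L/res-L1-s42-pv-2/CALIBRATION-W42-O2-v4.md` §4 (B1).  `Won m s C` (some generator has order `≤ m` — the exit
condition of the polyhedra game / `cornerPuzzle.done`, WEAKER than `Resolved`); E-resolved ⇒ won; and the re-threading fact behind the activity
clause: under the blow-up of a LEGAL face every child of a WON corner is won, and corners avoiding the new ray keep their status (`won_move_of_won`).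
NOT a statement of the manuscript under review.  AI work, weaker than expert review.  No `sorry`, no new axiom.
-/

set_option linter.dupNamespace false -- mandated namespace of this single-conjunct summit

namespace Summit.ResolutionOfSingularities.ResolutionOfSingularities.Theorems.CampaignW42.Toric

namespace TState

open Finset

variable {ι : Type}

/-- **[OURS · L1 W4.2]** The corner `C` is WON (the polyhedra game's / `cornerPuzzle`'s exit condition, `≤`): some generator has order `≤ m`. -/
def Won (m : ℕ) (s : TState ι) (C : Finset ℕ) : Prop := ∃ v, s.faceSum C v ≤ m

/-- E-resolved corners are won. -/
theorem Won.of_resolved {m : ℕ} {s : TState ι} {C : Finset ℕ} (h : s.Resolved m C) : s.Won m C := by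
  obtain ⟨v, hv⟩ := h; exact ⟨v, hv.le⟩

/-- An E-resolved state has every corner won (`cornerPuzzle`'s `done`, up to the dictionary). -/
theorem won_of_eresolved {m : ℕ} {s : TState ι} (h : s.EResolved m) : ∀ C ∈ s.cones, s.Won m C :=
  fun C hC => Won.of_resolved (h C hC)

/-- A won corner avoiding the new ray stays won after a blow-up. -/
theorem Won.move_of_not_mem {m : ℕ} {s : TState ι} {R C : Finset ℕ} (h : s.Won m C) (hC : s.next ∉ C) : (s.move m R).Won m C := by
  obtain ⟨v, hv⟩ := h; exact ⟨v, by rw [faceSum_move_of_not_mem hC]; exact hv⟩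

/-- **(B1, first brick) Won corners stay won.**  Every child of a WON corner under the blow-up of a LEGAL face is won
(`Σ_{R∖x} a(v) ≤ Σ_C a(v) ≤ m` for the winning generator, with non-negative exponents). -/
theorem Won.child {m : ℕ} {s : TState ι} (hs : s.Nonneg) {R C : Finset ℕ} (hR : s.Legal m R) (hRC : R ⊆ C) (h : s.Won m C)
    {x : ℕ} (hx : x ∈ R) (hC : s.next ∉ C) : (s.move m R).Won m (insert s.next (C.erase x)) := by
  obtain ⟨v, hv⟩ := h
  refine ⟨v, ?_⟩
  rw [faceSum_child (hRC hx) hC v]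
  -- Σ_C a − a_x + (Σ_R a − m) ≤ m  since  Σ_R a − a_x ≤ Σ_C a − a_x ≤ m − a_x... precisely Σ_{R} a ≤ Σ_C a and a_x ≥ 0
  have h1 : s.faceSum R v ≤ s.faceSum C v := faceSum_mono_of_nonneg hs hRC v
  have h2 : s.expo x v ≤ s.faceSum R v := by
    unfold faceSum; exact Finset.single_le_sum (fun r _ => hs r v) hx
  have h3 := hR.2 v
  have h4 := hs x v
  omega

/-- Every cone of the blown-up state that descends from a won cone is won; cones avoiding the new ray keep their status. -/
theorem won_move_of_won {m : ℕ} {s : TState ι} (hs : s.Nonneg) (hwf : s.WF) {R : Finset ℕ} (hR : s.Legal m R) {D : Finset ℕ}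
    (hD : D ∈ (s.move m R).cones) (h : ∀ C ∈ s.cones, D ∈ s.children R C → s.Won m C) : (s.move m R).Won m D := by
  rw [mem_move_cones] at hD
  obtain ⟨C, hC, hDC⟩ := hD
  have hw := h C hC hDC
  have hnC := hwf.next_notMem hC
  by_cases hRC : R ⊆ C
  · rw [children_of_subset hRC, Finset.mem_image] at hDC
    obtain ⟨x, hx, rfl⟩ := hDC
    exact hw.child hs hR hRC hx hnC
  · rw [children_of_not_subset hRC, Finset.mem_singleton] at hDC
    subst hDC; exact hw.move_of_not_mem hnC

end TState

end Summit.ResolutionOfSingularities.ResolutionOfSingularities.Theorems.CampaignW42.Toric
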